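import Summits.HodgeConjecture.CorCM.IrreducibleOddWeightsOrbitBalanceCMFields
import Summits.HodgeConjecture.CorCM.IrreducibleOddWeightsHodgeGluing
import Summits.HodgeConjecture.CorCM.CMAbelianVarietyDimLeThreePowers
import HarnessLib

/-!
# ORBIT BALANCE through a TOWER `K_B ↪ M ↪ K_A`: a partner whose CM field embeds in a normal subfield `M` of `K_A` over
# which the type of `A` is equidistributed never interacts with `A`

COR-CM (cell `pub-hodgecm2`, binder seat `b16` gen 62, count-neutral claim ORBIT BALANCE, file O6 — CM fields and
realisations; theorems only, no definition, no named fact, no `sorry`).  NEW as stated, hence under `Summits/`.  HONEST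
FRAMING: unconditional statements about `dim MT(A × B)` and about Hodge classes on `A^a × B^b` being sums of products, plus
one CONDITIONAL gluing statement; `HC_CM` is neither used nor asserted.

File O3's named instance (`cmFamilyRank_add_card_eq_pair_of_shadow_eq_zero`) took the partner's field ITSELF as the
Galois pivot.  Here the partner's field `K_{i₁}` only EMBEDS into the pivot: `jB : K_{i₁} → M`, `jM : M → K_{i₀}`, `M`
normal over `ℚ`, `Φ_{i₀}` equidistributed over `M` (`2·#{t ∈ Φ_{i₀} | t ∘ jM = z} = #{t | t ∘ jM = z}` for all `z`).  Since
every complex embedding of `K_{i₁}` extends to `M` and all embeddings of `M` have the image `z₀(M)`, the Galois closure of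
`K_{i₁}` lies in `z₀(M)` (§1), so `L_{i₀} ∩ L_{i₁} ⊆ z₀(M)` and file O3's pairwise-pivot theorem applies:

* **`cmFamilyRank_add_card_eq_pair_of_tower`** — `Hg(A₀ × A₁) = Hg(A₀) × Hg(A₁)` whatever the type `Φ_{i₁}` of `K_{i₁}`:
  e.g. `A₀` with CM by `K ⊇ ℚ(ζ₇)` and type equidistributed over `ℚ(ζ₇)`, `A₁` ANY CM abelian variety with CM by a
  subfield of `ℚ(ζ₇)` — the elliptic curve `E_{ℚ(√−7)}`, or a threefold with CM by `ℚ(ζ₇)`; `A₀` over `K ⊇ M`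
  biquadratic CM and `A₁ = E_k` for either imaginary quadratic `k ⊂ M`;
* **`hodgeClassesProductSpan_biproduct_pair_of_tower`** — every rational Hodge class on every `A₀^a × A₁^b` is a
  `ℂ`-combination of exterior products of Hodge classes of the factors (no mixed exceptional classes; unconditional);
* **`hodgeConjectureFor_biproduct_pair_of_tower_of_powSucc`** — if moreover `[K_{i₁} : ℚ] ≤ 6`, the Hodge conjecture on
  every `A₀^a × A₁^b` follows from the Hodge conjecture for the powers of `A₀` ALONE (the powers of `A₁`, of dimension
  `≤ 3`, are divisor-generated: Moonen–Zarhin (5.2), tree `CMAbelianVarietyDimLeThreePowers`).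

## References

* [Shimura1998] G. Shimura, *Abelian Varieties with Complex Multiplication and Modular Functions*, §8.1, §8.3 (after
  Prop. 28: embeddings of a subfield extend).
* [MoonenZarhin1999LowDim] B. Moonen, Yu. Zarhin, Math. Ann. 315 (1999), §3 (3.1), §5 (5.2).
* [Gordon1999HodgeAVSurvey] B. B. Gordon, *A survey of the Hodge conjecture for abelian varieties*, §3 Theorem (proof),
  7.5–7.7, 9.4.3.
* [vanGeemen1994HodgeAV] B. van Geemen, LNM 1594 (1994), §3.5–3.7 Lemma 3.7 (p. 236).
-/

set_option autoImplicit false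

noncomputable section

open scoped BigOperators Classical

open CategoryTheory CategoryTheory.Limits NumberField IntermediateField

namespace Summit.HodgeConjecture.CorCM

open Literature.NumberTheory.ComplexMultiplication
open Literature.AlgebraicGeometry.Motives (AbelianVariety CMType)
open Literature.AlgebraicGeometry.Motives.AbelianVariety
open Literature.AlgebraicGeometry.HodgeTheory
open Literature.AlgebraicGeometry.ComplexMultiplication (IsCMTypeRealisation)
open Literature.AlgebraicGeometry.Pohlmann1968

/-! ### §1 The Galois closure of a subfield of a normal field `M` lies in `z₀(M)` -/

section Closure

variable {B M : Type} [Field B] [NumberField B] [Field M] [NumberField M] [Normal ℚ M]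

/-- Every complex embedding of `B ↪ M` lands in `z₀(M)` (it extends to `M`, whose embeddings all have the image `z₀(M)`).
[cite: Shimura1998, §8.1 and §8.3 (after Prop. 28)] -/
theorem apply_mem_range_of_tower (jB : B →+* M) (z₀ : M →+* ℂ) (f : B →+* ℂ) (b : B) : f b ∈ Set.range z₀ := by
  letI : Algebra B M := jB.toAlgebra
  have hlift : (ComplexEmbedding.lift M f).comp (algebraMap B M) = f := ComplexEmbedding.lift_comp_algebraMap M f
  have hb : f b = (ComplexEmbedding.lift M f) (jB b) := (RingHom.congr_fun hlift b).symm
  rw [hb]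
  exact apply_mem_range_of_normal z₀ (ComplexEmbedding.lift M f) (jB b)

/-- **The Galois closure of `B` in `ℂ` lies inside `z₀(M)`** when `B` embeds in the normal field `M`.
[cite: Shimura1998, §8.1] -/
theorem mem_range_of_mem_normalClosure_of_tower (jB : B →+* M) (z₀ : M →+* ℂ) {z : ℂ}
    (hz : z ∈ normalClosure ℚ B ℂ) : z ∈ Set.range z₀ := by
  have hle : normalClosure ℚ B ℂ ≤ z₀.toRatAlgHom.fieldRange := by
    rw [normalClosure_le_iff]
    intro f
    rintro _ ⟨y, rfl⟩
    obtain ⟨m, hm⟩ := apply_mem_range_of_tower jB z₀ (f : B →+* ℂ) y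
    exact ⟨m, hm⟩
  obtain ⟨m, hm⟩ := hle hz
  exact ⟨m, hm⟩

end Closure

/-! ### §2 The rank: `Hg(A₀ × A₁) = Hg(A₀) × Hg(A₁)` through the tower -/

section Rank

variable {I : Type} [Fintype I] {K : I → Type} [∀ i, Field (K i)] [∀ i, NumberField (K i)] [∀ i, IsCMField (K i)]
  {M : Type} [Field M] [NumberField M] [Normal ℚ M]

/-- **TOWER `K_{i₁} ↪ M ↪ K_{i₀}`, `M` NORMAL, `Φ_{i₀}` EQUIDISTRIBUTED OVER `M` ⟹ `Hg(A₀ × A₁) = Hg(A₀) × Hg(A₁)`** for the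
two-slot family, whatever `Φ_{i₁}`: `cmFamilyRank Φ + 2 = cmTypeRank Φ_{i₀} + cmTypeRank Φ_{i₁} + 1`.
[cite: Gordon1999HodgeAVSurvey, §3 Theorem (proof), 7.7 and 9.4.3] [cite: Shimura1998, §8.1 and §8.3] -/
theorem cmFamilyRank_add_card_eq_pair_of_tower {i₀ i₁ : I} (h01 : i₀ ≠ i₁) (hI : ∀ l, l = i₀ ∨ l = i₁)
    (Φ : ∀ i, CMType (K i)) (jB : K i₁ →+* M) (jM : M →+* K i₀)
    (hbal : ∀ z : M →+* ℂ, 2 * (Finset.univ.filter fun t : K i₀ →+* ℂ => t.comp jM = z ∧ t ∈ (Φ i₀).1).card =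
      (Finset.univ.filter fun t : K i₀ →+* ℂ => t.comp jM = z).card) :
    CMAlgebra.cmFamilyRank Φ + Fintype.card I = (∑ i, cmTypeRank (Φ i)) + 1 := by
  haveI : Nonempty I := ⟨i₀⟩
  obtain ⟨z₀⟩ : Nonempty (M →+* ℂ) := inferInstance
  have hL : ∀ z : ℂ, z ∈ normalClosure ℚ (K i₁) ℂ → z ∈ Set.range z₀ := fun z hz =>
    mem_range_of_mem_normalClosure_of_tower jB z₀ hz
  refine cmFamilyRank_add_card_eq_of_pairwise_pivot Φ fun i i' hii' => ?_
  rcases hI i with rfl | rfl <;> rcases hI i' with rfl | rfl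
  · exact absurd rfl hii'
  · exact Or.inl ⟨M, inferInstance, inferInstance, inferInstance, jM, z₀, fun z _ hz => hL z hz, hbal⟩
  · exact Or.inr ⟨M, inferInstance, inferInstance, inferInstance, jM, z₀, fun z _ hz => hL z hz, hbal⟩
  · exact absurd rfl hii'

end Rank

/-! ### §3 Realisations -/

section Hodge

variable {I J₁ J₂ : Type} [Fintype I] [Fintype J₁] [Fintype J₂] {K : I → Type} [∀ i, Field (K i)]
  [∀ i, NumberField (K i)] [∀ i, IsCMField (K i)] {Φ : ∀ i, CMType (K i)} {A : I → AbelianVariety ℂ}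
  {ιA : ∀ i, 𝓞 (K i) →+* End (A i)} {θ : ∀ i, K i →+* Module.End ℂ (complexBetti (A i).X 1)}
  {M : Type} [Field M] [NumberField M] [Normal ℚ M]

/-- **No mixed exceptional classes through a tower**: every rational Hodge class on every `(⨁_j A_{π₁ j}) × (⨁_j A_{π₂ j})`
with disjoint slot maps (every `A₀^a × A₁^b`) is a `ℂ`-combination of exterior products of Hodge classes of the factors.
[cite: MoonenZarhin1999LowDim, §3 (3.1)] [cite: Gordon1999HodgeAVSurvey, 7.7] -/
theorem hodgeClassesProductSpan_biproduct_pair_of_tower [Nonempty J₁] [Nonempty J₂] {i₀ i₁ : I} (h01 : i₀ ≠ i₁)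
    (hI : ∀ l, l = i₀ ∨ l = i₁) (jB : K i₁ →+* M) (jM : M →+* K i₀)
    (hbal : ∀ z : M →+* ℂ, 2 * (Finset.univ.filter fun t : K i₀ →+* ℂ => t.comp jM = z ∧ t ∈ (Φ i₀).1).card =
      (Finset.univ.filter fun t : K i₀ →+* ℂ => t.comp jM = z).card)
    (hA : ∀ i, IsCMTypeRealisation (Φ i) (A i) (ιA i) (θ i)) (π₁ : J₁ → I) (π₂ : J₂ → I)
    (hdisj : ∀ j₁ j₂, π₁ j₁ ≠ π₂ j₂) :
    HodgeClassesProductSpan (⨁ fun j => A (π₁ j)) (⨁ fun j => A (π₂ j)) :=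
  hodgeClassesProductSpan_biproduct_of_cmFamilyRank_add_card_eq (cmFamilyRank_add_card_eq_pair_of_tower h01 hI Φ jB jM hbal)
    hA π₁ π₂ hdisj

/-- **Hodge gluing through a tower, partner of degree `≤ 6`**: the Hodge conjecture on every `A₀^a × A₁^b` follows from the
Hodge conjecture for the powers of `A₀` alone (the powers of `A₁`, a CM abelian variety of dimension `≤ 3`, are
divisor-generated). [cite: MoonenZarhin1999LowDim, §3 (3.1) and §5 (5.2)] [cite: vanGeemen1994HodgeAV, §3.5–3.7 Lemma 3.7 (p. 236)] -/
theorem hodgeConjectureFor_biproduct_pair_of_tower_of_powSucc {i₀ i₁ : I} (h01 : i₀ ≠ i₁) (hI : ∀ l, l = i₀ ∨ l = i₁)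
    (h6 : Module.finrank ℚ (K i₁) ≤ 6) (jB : K i₁ →+* M) (jM : M →+* K i₀)
    (hbal : ∀ z : M →+* ℂ, 2 * (Finset.univ.filter fun t : K i₀ →+* ℂ => t.comp jM = z ∧ t ∈ (Φ i₀).1).card =
      (Finset.univ.filter fun t : K i₀ →+* ℂ => t.comp jM = z).card)
    (hA : ∀ i, IsCMTypeRealisation (Φ i) (A i) (ιA i) (θ i))
    (hHC : ∀ N : ℕ, HodgeConjectureFor ((A i₀).powSucc N).dim ((A i₀).powSucc N).X)
    {J : Type} [Fintype J] [Nonempty J] (π : J → I) :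
    HodgeConjectureFor (⨁ fun l => A (π l)).dim (⨁ fun l => A (π l)).X := by
  refine hodgeConjectureFor_biproduct_of_cmFamilyRank_add_card_eq (cmFamilyRank_add_card_eq_pair_of_tower h01 hI Φ jB jM hbal)
    hA (fun i N => ?_) π
  rcases hI i with rfl | rfl
  · exact hHC N
  · have hdim : (A i).dim = Module.finrank ℚ (K i) / 2 := Literature.AlgebraicGeometry.Motives.schemeDim_eq_holds (hA i).1
    exact hodgeConjectureFor_of_isDivisorGenerated _
      (isDivisorGenerated_powSucc_of_isOfCMType_of_dim_le_three (hA i).isOfCMType (by omega) N)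

/-- **Partner of ODD dimension (`[K_{i₁}:ℚ]/2` odd) and SIMPLE with nondegenerate… — not needed**: for a partner of ANY
degree, the Hodge conjecture for the powers of BOTH members gives it on all products through the tower.
[cite: MoonenZarhin1999LowDim, §3 (3.1)] [cite: vanGeemen1994HodgeAV, §3.5–3.7 Lemma 3.7 (p. 236)] -/
theorem hodgeConjectureFor_biproduct_pair_of_tower_of_powSucc' {i₀ i₁ : I} (h01 : i₀ ≠ i₁) (hI : ∀ l, l = i₀ ∨ l = i₁)
    (jB : K i₁ →+* M) (jM : M →+* K i₀)
    (hbal : ∀ z : M →+* ℂ, 2 * (Finset.univ.filter fun t : K i₀ →+* ℂ => t.comp jM = z ∧ t ∈ (Φ i₀).1).card =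
      (Finset.univ.filter fun t : K i₀ →+* ℂ => t.comp jM = z).card)
    (hA : ∀ i, IsCMTypeRealisation (Φ i) (A i) (ιA i) (θ i))
    (hHC : ∀ (i : I) (N : ℕ), HodgeConjectureFor ((A i).powSucc N).dim ((A i).powSucc N).X)
    {J : Type} [Fintype J] [Nonempty J] (π : J → I) :
    HodgeConjectureFor (⨁ fun l => A (π l)).dim (⨁ fun l => A (π l)).X :=
  hodgeConjectureFor_biproduct_of_cmFamilyRank_add_card_eq (cmFamilyRank_add_card_eq_pair_of_tower h01 hI Φ jB jM hbal)
    hA hHC π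

end Hodge

end Summit.HodgeConjecture.CorCM

end
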